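import Mathlib
import Summits.Ventures.LatticeQCDFlow.Scaling.SlabChainVanishing

/-!
# LatticeQCDFlow / Scaling — slab chains: the leading replica term is twice the single-chain
# character integral — file 4 of the slab-chain proof of (LC) at every separation

HONEST FRAMING: exact (Metropolis-corrected) sampling algorithms for lattice gauge theory;
figures of merit are autocorrelation/cost numbers at stated couplings and volumes; no
continuum-physics claim.

Venture `LatticeQCDFlow` (cell pub-lqcd), topic `Scaling`, FANOUT row 30 (lean-1) — OUR WORK (LEAD
LINE 230 (G3′)).  Layers `η : Fin (n+1) → E` (law `ν_E = μ^{⊗(n+1)}`), an observable `x(η_0)` at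
height `0` and `y(η_τ)` at height `τ` (`1 ≤ τ ≤ n`), and two-layer functions `ρ_h(η_h, η_{h+1})`
with vanishing `μ`-marginals in each slot.  After the product of doubled slab kernels is expanded,
the only surviving term of order `β^{gτ}` is the replica integral
`∫∫ (x(η_0) − x(η'_0))(y(η_τ) − y(η'_τ)) ∏_{h<τ} (ρ_h(η_h,η_{h+1}) + ρ_h(η'_h,η'_{h+1})) d(ν_E ⊗ ν_E)`,
and this file evaluates it EXACTLY:
* `integral_site_chainProd_eq_zero_of_mixed` — for `∅ ≠ A ⊊ [0, τ)` the single-chain integral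
  `∫ u(η_0) w(η_τ) ∏_{h∈A} ρ_h dν_E` vanishes (some layer is only a first or only a second argument:
  `exists_free_layer`, then the free-layer lemmas of `Scaling/SlabChainVanishing.lean`);
  `integral_x_chainProd_eq_zero`, `integral_w_chainProd_eq_zero` — the full chain `[0, τ)` kills a
  lone `x(η_0)` (free layer `τ`) and a lone `w(η_τ)` (free layer `0`);
* **`replica_leading_eq_two_mul`** — the replica integral equals
  `2 · ∫ x(η_0) y(η_τ) ∏_{h<τ} ρ_h(η_h, η_{h+1}) dν_E` (expand the product over subsets `A ⊆ [0,τ)`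
  with `Finset.prod_add`, split the replicas with `integral_prod_mul`; only `A = ∅` and `A = [0,τ)`
  survive, each contributing the single-chain integral).
Elementary; nothing is cited as a fact; no `def`, no `sorry`.
-/

noncomputable section

open MeasureTheory Filter Topology Finset

namespace Summit.Ventures.LatticeQCDFlow.Theory2.SlabChain

variable {n : ℕ} {E : Type*} [MeasurableSpace E] (μ : Measure E) [IsProbabilityMeasure μ]

/-! ## 1. Combinatorics of a proper non-empty sub-chain of `[0, τ)` -/

/-- Successor values below the top height do not wrap. [folklore] -/
theorem val_add_one_of_val_lt {h : Fin (n + 1)} (hh : h.val < n) : (h + 1).val = h.val + 1 := by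
  rw [Fin.val_add_one]
  split_ifs with hl
  · rw [hl, Fin.val_last] at hh; omega
  · rfl

/-- Predecessor of a positive height: `h + 1 = k` with `h.val + 1 = k.val`. [folklore] -/
theorem exists_add_one_eq {k : Fin (n + 1)} (hk : 1 ≤ k.val) :
    ∃ h : Fin (n + 1), h + 1 = k ∧ h.val + 1 = k.val := by
  have hk' : k.val < n + 1 := k.isLt
  refine ⟨⟨k.val - 1, by omega⟩, Fin.ext ?_, ?_⟩
  · rw [val_add_one_of_val_lt (by rw [Fin.val_mk]; omega), Fin.val_mk]
    omega
  · rw [Fin.val_mk]; omega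

/-- The height `0` lies below a positive height. [folklore] -/
theorem zero_mem_Iio {τ : Fin (n + 1)} (hτ1 : 1 ≤ τ.val) : (0 : Fin (n + 1)) ∈ Iio τ :=
  mem_Iio.2 (Fin.lt_def.2 (by rw [Fin.val_zero]; omega))

/-- A positive height is not `0`. [folklore] -/
theorem ne_zero_of_one_le {τ : Fin (n + 1)} (hτ1 : 1 ≤ τ.val) : τ ≠ 0 := fun h => by
  rw [h, Fin.val_zero] at hτ1; omega

/-- **A proper non-empty sub-chain of `[0, τ)` has a free layer**: some `h₀ ∈ A` is no successor of
an element of `A` and is not `0` (its layer is only a first argument), or some `h₀ ∈ A` has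
`h₀ + 1 ∉ A`, `h₀ + 1 ≠ τ` (the layer `h₀ + 1` is only a second argument). [folklore] -/
theorem exists_free_layer {τ : Fin (n + 1)} {A : Finset (Fin (n + 1))}
    (hA : A ⊆ Iio τ) (hne : A.Nonempty) (hA' : A ≠ Iio τ) :
    (∃ h₀ ∈ A, h₀ ≠ 0 ∧ ∀ h ∈ A, h + 1 ≠ h₀) ∨
      (∃ h₀ ∈ A, h₀ + 1 ≠ τ ∧ h₀ + 1 ≠ 0 ∧ ∀ h ∈ A, h ≠ h₀ + 1) := by
  have hτn : τ.val ≤ n := Nat.lt_succ_iff.mp τ.isLt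
  have hval : ∀ h ∈ A, (h + 1).val = h.val + 1 := fun h hh =>
    val_add_one_of_val_lt (by have := mem_Iio.1 (hA hh); omega)
  by_cases h0 : (0 : Fin (n + 1)) ∈ A
  · -- the first gap above `0`
    right
    have hK : (Iio τ \ A).Nonempty := by
      rw [Finset.sdiff_nonempty]
      intro hsub
      exact hA' (Finset.Subset.antisymm hA hsub)
    set k₀ := (Iio τ \ A).min' hK with hk₀
    have hk₀mem : k₀ ∈ Iio τ \ A := Finset.min'_mem _ hK
    have hk₀τ : k₀ < τ := mem_Iio.1 (Finset.mem_sdiff.1 hk₀mem).1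
    have hk₀A : k₀ ∉ A := (Finset.mem_sdiff.1 hk₀mem).2
    have hk₀0 : k₀.val ≠ 0 := fun h => hk₀A (by
      have : k₀ = 0 := Fin.ext (by rw [h, Fin.val_zero])
      rw [this]; exact h0)
    obtain ⟨h₀, hsucc, hval₀⟩ := exists_add_one_eq (k := k₀) (by omega)
    have hh₀A : h₀ ∈ A := by
      by_contra hc
      have hmem : h₀ ∈ Iio τ \ A := Finset.mem_sdiff.2 ⟨mem_Iio.2 (by
        rw [Fin.lt_def]; have := Fin.lt_def.1 hk₀τ; omega), hc⟩
      have hle := Finset.min'_le _ _ hmem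
      rw [← hk₀, Fin.le_def] at hle
      omega
    refine ⟨h₀, hh₀A, ?_, ?_, fun h hh heq => hk₀A ?_⟩
    · rw [hsucc]; exact ne_of_lt hk₀τ
    · rw [hsucc]; exact fun h => hk₀0 (by rw [h, Fin.val_zero])
    · rw [hsucc] at heq; rw [← heq]; exact hh
  · -- the minimum of `A` is not `0`
    left
    set h₀ := A.min' hne with hh₀
    refine ⟨h₀, Finset.min'_mem _ hne, fun h => h0 (by rw [← h]; exact Finset.min'_mem _ hne),
      fun h hh heq => ?_⟩
    have hle := Finset.min'_le _ _ hh
    rw [← hh₀, Fin.le_def] at hle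
    have hv := hval h hh
    rw [heq] at hv
    omega

/-! ## 2. Single-chain integrals with site observables -/

section Single

variable {ρ : Fin (n + 1) → E → E → ℂ} {Mρ : ℝ} {u w : E → ℂ} {Bu Bw : ℝ}

/-- The site observable `u(η_0) w(η_τ)` is measurable. [folklore] -/
theorem measurable_site (hum : Measurable u) (hwm : Measurable w) (τ : Fin (n + 1)) :
    Measurable fun η : Fin (n + 1) → E => u (η 0) * w (η τ) :=
  (hum.comp (measurable_pi_apply 0)).mul (hwm.comp (measurable_pi_apply τ))

omit [MeasurableSpace E] in
/-- Bound of the site observable. [folklore] -/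
theorem norm_site_le (hub : ∀ e, ‖u e‖ ≤ Bu) (hwb : ∀ e, ‖w e‖ ≤ Bw) (τ : Fin (n + 1))
    (η : Fin (n + 1) → E) : ‖u (η 0) * w (η τ)‖ ≤ Bu * Bw := by
  rw [norm_mul]
  exact mul_le_mul (hub _) (hwb _) (norm_nonneg _) ((norm_nonneg _).trans (hub (η 0)))

variable (hρm : ∀ h, Measurable (Function.uncurry (ρ h))) (hρb : ∀ h e e', ‖ρ h e e'‖ ≤ Mρ)
  (hρ₁ : ∀ h e', ∫ e, ρ h e e' ∂μ = 0) (hρ₂ : ∀ h e, ∫ e', ρ h e e' ∂μ = 0)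
  (hum : Measurable u) (hwm : Measurable w) (hub : ∀ e, ‖u e‖ ≤ Bu) (hwb : ∀ e, ‖w e‖ ≤ Bw)

include hρm hρb hum hwm hub hwb

include hρ₁ hρ₂ in
/-- **A proper non-empty sub-chain kills the site observable**: for `∅ ≠ A ⊊ [0, τ)`,
`∫ u(η_0) w(η_τ) ∏_{h∈A} ρ_h(η_h, η_{h+1}) dν_E = 0`. [folklore] -/
theorem integral_site_chainProd_eq_zero_of_mixed {τ : Fin (n + 1)}
    {A : Finset (Fin (n + 1))} (hA : A ⊆ Iio τ) (hne : A.Nonempty) (hA' : A ≠ Iio τ) :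
    ∫ η, u (η 0) * w (η τ) * chainProd ρ A η ∂(Measure.pi fun _ : Fin (n + 1) => μ) = 0 := by
  rcases exists_free_layer hA hne hA' with ⟨h₀, hh₀, hne0, hpred⟩ | ⟨h₀, hh₀, hτ', h0', hsucc⟩
  · have hτ0 : h₀ ≠ τ := ne_of_lt (mem_Iio.1 (hA hh₀))
    refine integral_mul_chainProd_eq_zero_of_fst μ hρm hρb hh₀ hpred
      (measurable_site hum hwm τ) (norm_site_le hub hwb τ) (fun η e => ?_) (hρ₁ h₀)
    rw [Function.update_of_ne hne0.symm, Function.update_of_ne hτ0.symm]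
  · refine integral_mul_chainProd_eq_zero_of_snd μ hρm hρb hh₀ hsucc
      (measurable_site hum hwm τ) (norm_site_le hub hwb τ) (fun η e => ?_) (hρ₂ h₀)
    rw [Function.update_of_ne h0'.symm, Function.update_of_ne hτ'.symm]

omit hwm hwb in
include hρ₂ in
/-- **The full chain kills a lone observable at height `0`** (the layer `τ` is only the second
argument of `ρ_{τ−1}`): `∫ u(η_0) ∏_{h<τ} ρ_h dν_E = 0` for `1 ≤ τ`. [folklore] -/
theorem integral_u_chainProd_eq_zero {τ : Fin (n + 1)} (hτ1 : 1 ≤ τ.val) :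
    ∫ η, u (η 0) * chainProd ρ (Iio τ) η ∂(Measure.pi fun _ : Fin (n + 1) => μ) = 0 := by
  obtain ⟨h₀, hsucc, hval₀⟩ := exists_add_one_eq hτ1
  have hh₀mem : h₀ ∈ Iio τ := mem_Iio.2 (by rw [Fin.lt_def]; omega)
  have hτ0 : (τ : Fin (n + 1)) ≠ 0 := ne_zero_of_one_le hτ1
  refine integral_mul_chainProd_eq_zero_of_snd μ hρm hρb hh₀mem (fun h hh => ?_)
    (hum.comp (measurable_pi_apply 0)) (fun η => hub (η 0)) (fun η e => ?_) (hρ₂ h₀)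
  · rw [hsucc]; exact ne_of_lt (mem_Iio.1 hh)
  · rw [hsucc, Function.update_of_ne hτ0.symm]

omit hum hub in
include hρ₁ in
/-- **The full chain kills a lone observable at height `τ`** (the layer `0` is only the first
argument of `ρ_0`): `∫ w(η_τ) ∏_{h<τ} ρ_h dν_E = 0` for `1 ≤ τ`. [folklore] -/
theorem integral_w_chainProd_eq_zero {τ : Fin (n + 1)} (hτ1 : 1 ≤ τ.val) :
    ∫ η, w (η τ) * chainProd ρ (Iio τ) η ∂(Measure.pi fun _ : Fin (n + 1) => μ) = 0 := by
  have h0mem : (0 : Fin (n + 1)) ∈ Iio τ := zero_mem_Iio hτ1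
  have hτ0 : (τ : Fin (n + 1)) ≠ 0 := ne_zero_of_one_le hτ1
  refine integral_mul_chainProd_eq_zero_of_fst μ hρm hρb h0mem (fun h hh heq => ?_)
    (hwm.comp (measurable_pi_apply τ)) (fun η => hwb (η τ)) (fun η e => ?_) (hρ₁ 0)
  · have hv := val_add_one_of_val_lt (h := h)
      (by have := mem_Iio.1 hh; rw [Fin.lt_def] at this; omega)
    rw [heq, Fin.val_zero] at hv
    omega
  · rw [Function.update_of_ne hτ0]

end Single

/-! ## 3. The replica integral -/

section Replica

omit [IsProbabilityMeasure μ] in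
/-- Linearity for four integrable terms. [folklore] -/
theorem integral_sub_sub_add {Ω : Type*} [MeasurableSpace Ω] {m : Measure Ω}
    {f₁ f₂ f₃ f₄ : Ω → ℂ} (h₁ : Integrable f₁ m) (h₂ : Integrable f₂ m) (h₃ : Integrable f₃ m)
    (h₄ : Integrable f₄ m) :
    ∫ a, (f₁ a - f₂ a - f₃ a + f₄ a) ∂m =
      (∫ a, f₁ a ∂m) - (∫ a, f₂ a ∂m) - (∫ a, f₃ a ∂m) + ∫ a, f₄ a ∂m := by
  have e : (fun a => f₁ a - f₂ a - f₃ a + f₄ a) = f₁ - f₂ - f₃ + f₄ := by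
    funext a; simp
  rw [e, integral_add' ((h₁.sub h₂).sub h₃) h₄, integral_sub' (h₁.sub h₂) h₃, integral_sub' h₁ h₂]

/-- Decoupled products of bounded measurable functions are integrable on the replica space.
[folklore] -/
theorem integrable_decoupled {f g : (Fin (n + 1) → E) → ℂ} (hf : Measurable f) (hg : Measurable g)
    {Cf Cg : ℝ} (hfb : ∀ η, ‖f η‖ ≤ Cf) (hgb : ∀ η, ‖g η‖ ≤ Cg) :
    Integrable (fun p : (Fin (n + 1) → E) × (Fin (n + 1) → E) => f p.1 * g p.2)
      ((Measure.pi fun _ : Fin (n + 1) => μ).prod (Measure.pi fun _ : Fin (n + 1) => μ)) := by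
  refine Integrable.of_bound ((hf.comp measurable_fst).mul (hg.comp measurable_snd)).aestronglyMeasurable
    (Cf * Cg) (Eventually.of_forall fun p => ?_)
  rw [norm_mul]
  exact mul_le_mul (hfb _) (hgb _) (norm_nonneg _) ((norm_nonneg _).trans (hfb p.1))

variable {ρ : Fin (n + 1) → E → E → ℂ} {Mρ : ℝ}
  (hρm : ∀ h, Measurable (Function.uncurry (ρ h))) (hρb : ∀ h e e', ‖ρ h e e'‖ ≤ Mρ)
  (hρ₁ : ∀ h e', ∫ e, ρ h e e' ∂μ = 0) (hρ₂ : ∀ h e, ∫ e', ρ h e e' ∂μ = 0)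
  {x y : E → ℝ} (hxm : Measurable x) (hym : Measurable y) {Bx By : ℝ}
  (hxb : ∀ e, |x e| ≤ Bx) (hyb : ∀ e, |y e| ≤ By)

include hρm hρb hρ₁ hρ₂ hxm hym hxb hyb

/-- **THE LEADING REPLICA TERM.**  For `1 ≤ τ` (`≤ n` automatically),
`∫∫ (x(η_0) − x(η'_0))(y(η_τ) − y(η'_τ)) ∏_{h<τ} (ρ_h(η_h, η_{h+1}) + ρ_h(η'_h, η'_{h+1})) d(ν_E ⊗ ν_E)
 = 2 ∫ x(η_0) y(η_τ) ∏_{h<τ} ρ_h(η_h, η_{h+1}) dν_E`. [folklore] -/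
theorem replica_leading_eq_two_mul {τ : Fin (n + 1)} (hτ1 : 1 ≤ τ.val) :
    ∫ p, (((x (p.1 0) - x (p.2 0)) * (y (p.1 τ) - y (p.2 τ)) : ℝ) : ℂ) *
        ∏ h ∈ Iio τ, (ρ h (p.1 h) (p.1 (h + 1)) + ρ h (p.2 h) (p.2 (h + 1)))
        ∂((Measure.pi fun _ : Fin (n + 1) => μ).prod (Measure.pi fun _ : Fin (n + 1) => μ)) =
      2 * ∫ η, (x (η 0) : ℂ) * (y (η τ) : ℂ) * chainProd ρ (Iio τ) η
        ∂(Measure.pi fun _ : Fin (n + 1) => μ) := by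
  set ν := Measure.pi fun _ : Fin (n + 1) => μ with hν
  set S₀ : Finset (Fin (n + 1)) := Iio τ with hS₀
  -- casts and bounds
  have hxm' : Measurable fun e => (x e : ℂ) := Complex.measurable_ofReal.comp hxm
  have hym' : Measurable fun e => (y e : ℂ) := Complex.measurable_ofReal.comp hym
  have hxb' : ∀ e, ‖(x e : ℂ)‖ ≤ Bx := fun e => by
    rw [Complex.norm_real, Real.norm_eq_abs]; exact hxb e
  have hyb' : ∀ e, ‖(y e : ℂ)‖ ≤ By := fun e => by
    rw [Complex.norm_real, Real.norm_eq_abs]; exact hyb e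
  have h1m : Measurable fun _ : E => (1 : ℂ) := measurable_const
  have h1b : ∀ e : E, ‖(fun _ : E => (1 : ℂ)) e‖ ≤ 1 := fun _ => by simp
  have hBx : 0 ≤ Bx := (abs_nonneg _).trans (hxb (Classical.choice (by
    by_contra hE
    rw [not_nonempty_iff] at hE
    have := IsProbabilityMeasure.measure_univ (μ := μ)
    rw [Set.univ_eq_empty_iff.2 hE, measure_empty] at this
    exact zero_ne_one this)))
  -- the four kinds of single-chain integrands: measurability and bounds
  have mP : ∀ B : Finset (Fin (n + 1)), Measurable (chainProd ρ B) := measurable_chainProd hρm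
  have bP : ∀ (B : Finset (Fin (n + 1))) η, ‖chainProd ρ B η‖ ≤ Mρ ^ B.card :=
    norm_chainProd_le hρb
  have mX : ∀ B : Finset (Fin (n + 1)), Measurable fun η : Fin (n + 1) → E =>
      (x (η 0) : ℂ) * chainProd ρ B η := fun B => (hxm'.comp (measurable_pi_apply 0)).mul (mP B)
  have bX : ∀ (B : Finset (Fin (n + 1))) η, ‖(x (η 0) : ℂ) * chainProd ρ B η‖ ≤ Bx * Mρ ^ B.card :=
    fun B η => by
      rw [norm_mul]; exact mul_le_mul (hxb' _) (bP B η) (norm_nonneg _) hBx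
  have mY : ∀ B : Finset (Fin (n + 1)), Measurable fun η : Fin (n + 1) → E =>
      (y (η τ) : ℂ) * chainProd ρ B η := fun B => (hym'.comp (measurable_pi_apply τ)).mul (mP B)
  have bY : ∀ (B : Finset (Fin (n + 1))) η, ‖(y (η τ) : ℂ) * chainProd ρ B η‖ ≤ By * Mρ ^ B.card :=
    fun B η => by
      rw [norm_mul]
      exact mul_le_mul (hyb' _) (bP B η) (norm_nonneg _) ((abs_nonneg _).trans (hyb (η τ)))
  have mXY : ∀ B : Finset (Fin (n + 1)), Measurable fun η : Fin (n + 1) → E =>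
      (x (η 0) : ℂ) * (y (η τ) : ℂ) * chainProd ρ B η :=
    fun B => ((hxm'.comp (measurable_pi_apply 0)).mul (hym'.comp (measurable_pi_apply τ))).mul (mP B)
  have bXY : ∀ (B : Finset (Fin (n + 1))) η,
      ‖(x (η 0) : ℂ) * (y (η τ) : ℂ) * chainProd ρ B η‖ ≤ Bx * By * Mρ ^ B.card := fun B η => by
    rw [norm_mul, norm_mul]
    exact mul_le_mul (mul_le_mul (hxb' _) (hyb' _) (norm_nonneg _) hBx) (bP B η) (norm_nonneg _)
      (by have := (abs_nonneg _).trans (hyb (η τ)); positivity)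
  -- expand the product over subsets of `S₀`
  have hexp : ∀ p : (Fin (n + 1) → E) × (Fin (n + 1) → E),
      ∏ h ∈ S₀, (ρ h (p.1 h) (p.1 (h + 1)) + ρ h (p.2 h) (p.2 (h + 1))) =
        ∑ A ∈ S₀.powerset, chainProd ρ A p.1 * chainProd ρ (S₀ \ A) p.2 := by
    intro p
    rw [Finset.prod_add]
    rfl
  -- the integrand of one subset, decoupled into the four replica-split products
  have hpt : ∀ (A : Finset (Fin (n + 1))) (p : (Fin (n + 1) → E) × (Fin (n + 1) → E)),
      (((x (p.1 0) - x (p.2 0)) * (y (p.1 τ) - y (p.2 τ)) : ℝ) : ℂ) *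
        (chainProd ρ A p.1 * chainProd ρ (S₀ \ A) p.2) =
      ((x (p.1 0) : ℂ) * (y (p.1 τ) : ℂ) * chainProd ρ A p.1) * chainProd ρ (S₀ \ A) p.2 -
        ((x (p.1 0) : ℂ) * chainProd ρ A p.1) * ((y (p.2 τ) : ℂ) * chainProd ρ (S₀ \ A) p.2) -
        ((y (p.1 τ) : ℂ) * chainProd ρ A p.1) * ((x (p.2 0) : ℂ) * chainProd ρ (S₀ \ A) p.2) +
        chainProd ρ A p.1 * ((x (p.2 0) : ℂ) * (y (p.2 τ) : ℂ) * chainProd ρ (S₀ \ A) p.2) := by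
    intro A p
    push_cast
    ring
  have hsplit : ∀ A : Finset (Fin (n + 1)),
      ∫ p, (((x (p.1 0) - x (p.2 0)) * (y (p.1 τ) - y (p.2 τ)) : ℝ) : ℂ) *
        (chainProd ρ A p.1 * chainProd ρ (S₀ \ A) p.2) ∂(ν.prod ν) =
      (∫ η, (x (η 0) : ℂ) * (y (η τ) : ℂ) * chainProd ρ A η ∂ν) *
          (∫ η, chainProd ρ (S₀ \ A) η ∂ν) -
        (∫ η, (x (η 0) : ℂ) * chainProd ρ A η ∂ν) *
          (∫ η, (y (η τ) : ℂ) * chainProd ρ (S₀ \ A) η ∂ν) -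
        (∫ η, (y (η τ) : ℂ) * chainProd ρ A η ∂ν) *
          (∫ η, (x (η 0) : ℂ) * chainProd ρ (S₀ \ A) η ∂ν) +
        (∫ η, chainProd ρ A η ∂ν) *
          (∫ η, (x (η 0) : ℂ) * (y (η τ) : ℂ) * chainProd ρ (S₀ \ A) η ∂ν) := by
    intro A
    simp_rw [hpt A]
    have i1 := integrable_decoupled μ (mXY A) (mP (S₀ \ A)) (bXY A) (bP (S₀ \ A))
    have i2 := integrable_decoupled μ (mX A) (mY (S₀ \ A)) (bX A) (bY (S₀ \ A))
    have i3 := integrable_decoupled μ (mY A) (mX (S₀ \ A)) (bY A) (bX (S₀ \ A))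
    have i4 := integrable_decoupled μ (mP A) (mXY (S₀ \ A)) (bP A) (bXY (S₀ \ A))
    refine (integral_sub_sub_add i1 i2 i3 i4).trans ?_
    rw [integral_prod_mul (fun η => (x (η 0) : ℂ) * (y (η τ) : ℂ) * chainProd ρ A η)
        (fun η => chainProd ρ (S₀ \ A) η),
      integral_prod_mul (fun η => (x (η 0) : ℂ) * chainProd ρ A η)
        (fun η => (y (η τ) : ℂ) * chainProd ρ (S₀ \ A) η),
      integral_prod_mul (fun η => (y (η τ) : ℂ) * chainProd ρ A η)
        (fun η => (x (η 0) : ℂ) * chainProd ρ (S₀ \ A) η),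
      integral_prod_mul (fun η => chainProd ρ A η)
        (fun η => (x (η 0) : ℂ) * (y (η τ) : ℂ) * chainProd ρ (S₀ \ A) η)]
  -- integrate the sum termwise
  have hterm : ∀ A ∈ S₀.powerset, Integrable (fun p : (Fin (n + 1) → E) × (Fin (n + 1) → E) =>
      (((x (p.1 0) - x (p.2 0)) * (y (p.1 τ) - y (p.2 τ)) : ℝ) : ℂ) *
        (chainProd ρ A p.1 * chainProd ρ (S₀ \ A) p.2)) (ν.prod ν) := by
    intro A _
    simp_rw [hpt A]
    have i1 := integrable_decoupled μ (mXY A) (mP (S₀ \ A)) (bXY A) (bP (S₀ \ A))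
    have i2 := integrable_decoupled μ (mX A) (mY (S₀ \ A)) (bX A) (bY (S₀ \ A))
    have i3 := integrable_decoupled μ (mY A) (mX (S₀ \ A)) (bY A) (bX (S₀ \ A))
    have i4 := integrable_decoupled μ (mP A) (mXY (S₀ \ A)) (bP A) (bXY (S₀ \ A))
    exact ((i1.sub i2).sub i3).add i4
  simp_rw [hexp, Finset.mul_sum]
  rw [integral_finsetSum _ hterm]
  simp_rw [hsplit]
  -- only `A = ∅` and `A = S₀` survive
  have hS₀ne : (∅ : Finset (Fin (n + 1))) ≠ S₀ := by
    intro h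
    have h0 : (0 : Fin (n + 1)) ∈ S₀ := zero_mem_Iio hτ1
    rw [← h] at h0
    simp at h0
  rw [Finset.sum_eq_add ∅ S₀ hS₀ne ?_ (by simp) (by simp)]
  · -- the two surviving terms
    have vX : ∫ η, (x (η 0) : ℂ) * chainProd ρ S₀ η ∂ν = 0 :=
      integral_u_chainProd_eq_zero μ hρm hρb hρ₂ hxm' hxb' hτ1
    have vY : ∫ η, (y (η τ) : ℂ) * chainProd ρ S₀ η ∂ν = 0 :=
      integral_w_chainProd_eq_zero μ hρm hρb hρ₁ hym' hyb' hτ1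
    have v1 : ∫ η, chainProd ρ S₀ η ∂ν = 0 := by
      have h := integral_w_chainProd_eq_zero μ hρm hρb hρ₁ h1m h1b hτ1 (τ := τ)
      simpa using h
    have e0 : ∀ η : Fin (n + 1) → E, chainProd ρ ∅ η = 1 := fun η => by simp [chainProd]
    simp only [Finset.sdiff_empty, Finset.sdiff_self, e0, mul_one, vX, vY, v1, zero_mul,
      mul_zero, sub_zero, integral_const, probReal_univ, one_smul, one_mul, add_zero, zero_add]
    ring
  · -- the mixed terms vanish
    intro A hA hAne
    have hA' : A ⊆ S₀ := Finset.mem_powerset.1 hA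
    have hne : A.Nonempty := Finset.nonempty_iff_ne_empty.2 hAne.1
    have hxy := integral_site_chainProd_eq_zero_of_mixed μ hρm hρb hρ₁ hρ₂ hxm' hym' hxb' hyb'
      hA' hne hAne.2
    have hx1 := integral_site_chainProd_eq_zero_of_mixed μ hρm hρb hρ₁ hρ₂ hxm' h1m hxb' h1b
      hA' hne hAne.2
    have h1y := integral_site_chainProd_eq_zero_of_mixed μ hρm hρb hρ₁ hρ₂ h1m hym' h1b hyb'
      hA' hne hAne.2
    have h11 := integral_site_chainProd_eq_zero_of_mixed μ hρm hρb hρ₁ hρ₂ h1m h1m h1b h1b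
      hA' hne hAne.2
    simp only [one_mul, mul_one] at hx1 h1y h11
    rw [hxy, hx1, h1y, h11]
    ring

end Replica

end Summit.Ventures.LatticeQCDFlow.Theory2.SlabChain

end
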